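import Summits.BirchSwinnertonDyer.BirchSwinnertonDyer.Theorems.ResidualThetaTransportAtTwoResidualSignedLambdaLowerCMAtTwoCofreeShapiroTransport
import Summits.BirchSwinnertonDyer.BirchSwinnertonDyer.Theorems.SchneiderFreeAdditiveX3PoitouTateUnramifiedOrthogonalAllLevels
import Summits.BirchSwinnertonDyer.BirchSwinnertonDyer.Theorems.SchneiderFreeAdditiveX3PoitouTateReciprocitySumHolds
import HarnessLib

/-!
# The LEVELWISE `SelmerComplement` call of the deep half AWAY from `2` (item 7 `stub_deepHalfAwayTwo` of the line `onepair`):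
# a class of `H¹(Γ_n, A_ρ[p^k])`, admissible, with PRESCRIBED local classes at `S₀`, from levelwise orthogonality against the
# dual classes that are relaxed at `S₀` and strict at `p` and `∞`

Route `ResidualThetaTransportAtTwo` (RTT), crux RSL_g `ResidualSignedLambdaLowerCMAtTwo` (stmt-BirchSwinnertonDyer-22608); seat
`prover-bsd-wall-tp2-p2x` g18 (`--supports 22608 --as helper`, closes nothing). THEOREMS ONLY (no definition, no named fact, no instance
declaration, no `sorry`). STUB-PLAN `stub_cmLambdaLower` rev 18/19 §3 item 8 (S4₀): «`hne` = selmerComplement(T40 S) + `…MackeyPackageGlue`»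
— the Q67 core call, here made for THE canonical invariant maps (`SchneiderFreeAdditiveX3.PoitouTateReduction.selmerComplement_canonical_holds`,
Milne I Thm. 4.10 (b) at every level for every admissible `S`) on `ρc := Maps(Γ_ℚ ⧸ Γ_n, A_ρ[p^k])` with the S4₀ Selmer structures:
`𝓖` = `⊤` on `S = {∞} ∪ {w ∋ p} ∪ S₀`, unramified outside; `𝓕 := 𝓖[S₀ ↦ ⊥]`. The dual structure `𝓕*` is then RELAXED at `S₀`, STRICT at
the places over `p` and at `∞`, unramified elsewhere — exactly the hypotheses `hur`/`hinf`/`hp` of the landed transfer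
`CofreeSelmerTransfer.transferH1_mem_relaxed_strict_of_shapiroLift` (p692705, card k3-g13 §4b; item 7's (T)_ρ).

`exists_admissible_prescribed_of_levelwise_orthogonal`: for PRESCRIBED local classes `t w ∈ H¹(ℚ_w, ρc)` (`w ∈ S₀`; e.g. with orbit
components prescribed by the K-d pins — `LayerPairingMackeyDual.exists_local_forall_component_eq`) and the LEVELWISE ORTHOGONALITY
`hT` (GLUE-7 shape: for every `b ∈ H¹(Γ_n, A_ρ[p^k])` with [unr] `Sh b` unramified at the finite `w ∉ S₀`, `w ∤ p`, [inf] `loc_∞ (Sh b) = 0`,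
[p] `loc_v (Sh b) = 0` for `v ∣ p`: `Σ_{w ∈ S₀} ⟨t w, loc_w (H¹(Ψ)(Sh b))⟩_w = 0`, THE canonical local Tate pairings mod `p^k`), there is
`c ∈ H¹(Γ_n, A_ρ[p^k])` ADMISSIBLE outside `S₀ ∪ {w ∋ p}` (the currency of `…CofreeAdmissible`) with `loc_w (Sh c) = t w` for every `w ∈ S₀`.
The `S₀`-terms are read orbit by orbit in layer currency by `LayerPairingNondegenerate.localTatePairingZMod_canonical_coind_eq_sum_layerPairingH1Of`
(p689642) — not needed here. No `Θ`, no points, no Coleman map, no pins; the exceptional set `S₀ ∌ p` is a parameter (T40).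

Proof: `SelmerComplement` (i) with `t` extended by `0` off `S₀`; the orthogonality input `Σ_{v ∈ S} ⟨t v, loc_v y⟩ = 0` for
`y ∈ H¹_{𝓕*}(ℚ, ρc^D)` reduces to the `S₀`-sum, and `y = H¹(Ψ)(Sh b)` (`CoindShapiroOfFun.existsUnique_shapiroLift_coindTateDual_eq`) with
[unr] (`unramifiedOrthogonal_of_isPerfect_allLevels` + `ShapiroTransport.localization_mem_unramifiedSubgroup_of_coindTateDual`), [inf]/[p]
(`⊤^⊥ = 0`: `eq_zero_of_forall_localTatePairingZMod_canonical[_inl]_eq_zero` + `ShapiroTransport.localization_eq_zero_of_localization_coindTateDual_eq_zero`);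
the output `x ∈ H¹_𝓖` with `loc_w x − t w ∈ 𝓕_w = ⊥` at `S₀` is `Sh c` with `c` admissible (`ShapiroTransport.admissible_of_forall_localization_shapiroLift_mem`).

HONEST FRAMING: `--supports` theorem, CONDITIONAL on `hT`; nothing about any count or `L`-value; BSD is not proved by any of this; RSL_g (22608)
and the K3 crux (20308) stay OPEN. References: [MilneADT2006] I Cor. 2.3, Thm. 2.6, 2.13 (a), 4.10 (b); [Howard2004HeegnerKolyvagin] Thm. 2.1.11,
Def. 2.1.6/2.1.10; [NeukirchSchmidtWingberg2008] I §6 (1.6.4); [Greenberg1989] §1 p. 98; [Kato2004Asterisque] §13.8; [Brown1982] III §5 (5.6)(b).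
-/

set_option autoImplicit false
-- the Theorems namespace of this sub repeats the summit name by design (D-0017 nested layout)
set_option linter.dupNamespace false

noncomputable section

open scoped Classical

namespace Summit.BirchSwinnertonDyer.BirchSwinnertonDyer.Theorems

namespace ThetaTransport.DeepHalfLevelwiseAway

open CategoryTheory Field NumberField IsDedekindDomain
  Literature.NumberTheory.EllipticCurves Literature.NumberTheory.EllipticCurves.CyclotomicLayer
  Literature.NumberTheory.EllipticCurves.GreenbergSelmer
  Literature.NumberTheory.GaloisRepresentations Literature.NumberTheory.GaloisRepresentations.DiscreteGaloisModule
  Literature.NumberTheory.GaloisCohomology ZpExtension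
open SignedLowerOffTwo.PTDeep (eq_zero_of_forall_localTatePairingZMod_canonical_eq_zero
  eq_zero_of_forall_localTatePairingZMod_canonical_inl_eq_zero)
open ThetaTransport.CoindShapiroOfFun (existsUnique_shapiroLift_coindTateDual_eq)
open ThetaTransport.ShapiroTransport (admissible_of_forall_localization_shapiroLift_mem
  isUnramifiedAt_coind_cofreeTorsionGaloisModule_layerSubgroup localization_eq_zero_of_localization_coindTateDual_eq_zero
  localization_mem_unramifiedSubgroup_of_coindTateDual)

variable {p : ℕ} [Fact p.Prime] (S : Set (PadicAlgCl p)) {d : ℕ} (ρ : FramedGaloisRep ℚ ↥(padicCoeffIntegers S) d) (k : ℕ)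
  [Finite ↥(AddSubgroup.torsionBy (Cofree ρ ↥(padicCoeffField S)) ((p ^ k : ℕ) : ℤ))]
  (ePk : ∀ k : ℕ, ↥(AddSubgroup.torsionBy (Cofree ρ ↥(padicCoeffField S)) ((p ^ k : ℕ) : ℤ)) →
    ↥(AddSubgroup.torsionBy (Cofree ρ ↥(padicCoeffField S)) ((p ^ k : ℕ) : ℤ)) → AlgebraicClosure ℚ)
  (hμPk : ∀ k a b, ePk k a b ^ (p ^ k) = 1)
  (hadd₁Pk : ∀ k a₁ a₂ b, ePk k (a₁ + a₂) b = ePk k a₁ b * ePk k a₂ b)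
  (hadd₂Pk : ∀ k a b₁ b₂, ePk k a (b₁ + b₂) = ePk k a b₁ * ePk k a b₂)
  (hgalPk : ∀ k (σ : absoluteGaloisGroup ℚ) (a b : ↥(AddSubgroup.torsionBy (Cofree ρ ↥(padicCoeffField S)) ((p ^ k : ℕ) : ℤ))),
    σ • ePk k a b = ePk k (cofreeTorsionGaloisModule S ρ _ σ a) (cofreeTorsionGaloisModule S ρ _ σ b))
  (hnondeg : ∀ T, (∀ a, ePk k a T = 1) → T = 0)
  (κ : ZpExtension ℚ p)
  (S₀ : Finset (HeightOneSpectrum (𝓞 ℚ))) (hS₀ : ∀ w ∈ S₀, (p : 𝓞 ℚ) ∉ w.asIdeal)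
  (hρ : ∀ w : HeightOneSpectrum (𝓞 ℚ), w ∉ S₀ → (p : 𝓞 ℚ) ∉ w.asIdeal → ρ.IsUnramifiedAt w)
  (n : ℕ) [Fintype (absoluteGaloisGroup ℚ ⧸ κ.layerSubgroup n)]
  {s : absoluteGaloisGroup ℚ ⧸ κ.layerSubgroup n → absoluteGaloisGroup ℚ}
  (hs : ∀ x : absoluteGaloisGroup ℚ ⧸ κ.layerSubgroup n, (s x : absoluteGaloisGroup ℚ ⧸ κ.layerSubgroup n) = x)
  (hs1 : s ((1 : absoluteGaloisGroup ℚ) : absoluteGaloisGroup ℚ ⧸ κ.layerSubgroup n) = 1)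

include hnondeg hS₀ hρ in
-- one `(n, k)`-level assembly in a single declaration (as `DeepHalfLevelwise.exists_admissible_strict_valueCond_of_levelwise_orthogonal`):
-- the `ρ`-coefficient module `A_ρ[p^k]` makes every `whnf`/`isDefEq` on the Selmer-structure types dear
set_option maxHeartbeats 3200000 in
/-- **Levelwise `SelmerComplement` call away from `p`, PRESCRIBED at `S₀`.** See the module docstring. For prescribed local classes `t w`
(`w ∈ S₀`) and the levelwise orthogonality `hT` (against the dual classes relaxed at `S₀`, strict at `p` and `∞`), some
`c ∈ H¹(Γ_n, A_ρ[p^k])` is admissible outside `S₀ ∪ {w ∋ p}` and has `loc_w (Sh c) = t w` for every `w ∈ S₀`. CONDITIONAL on `hT`; credit nothing.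
[cite: MilneADT2006, Ch. I, Thm. 4.10(b), Cor. 2.3, Thm. 2.6, Thm. 2.13] [cite: Howard2004HeegnerKolyvagin, Thm. 2.1.11 (arXiv:1202.6340 p. 6)]
[cite: NeukirchSchmidtWingberg2008, I §6 Prop. (1.6.4)] -/
theorem exists_admissible_prescribed_of_levelwise_orthogonal [CompactSpace (absoluteGaloisGroup ℚ)]
    (t : ∀ w : HeightOneSpectrum (𝓞 ℚ), galoisCohomology
      (((cofreeTorsionGaloisModule S ρ ((p ^ k : ℕ) : ℤ)).coind (κ.layerSubgroup n) (κ.isOpen_layerSubgroup n)).toLocal (Sum.inr w)) 1)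
    (hT : ∀ (b : H1 (cofreeTorsionGaloisModule S ρ ((p ^ k : ℕ) : ℤ)) (κ.layerSubgroup n)),
      (∀ w : HeightOneSpectrum (𝓞 ℚ), w ∉ S₀ → (p : 𝓞 ℚ) ∉ w.asIdeal →
        galoisCohomology.localization
            ((cofreeTorsionGaloisModule S ρ ((p ^ k : ℕ) : ℤ)).coind (κ.layerSubgroup n) (κ.isOpen_layerSubgroup n)) (Sum.inr w) 1
            (shapiroLift (cofreeTorsionGaloisModule S ρ ((p ^ k : ℕ) : ℤ)).toTopRep (κ.layerSubgroup n) (κ.isOpen_layerSubgroup n)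
              hs hs1 b) ∈
          unramifiedSubgroup (GaloisRep.toLocal w
            ((cofreeTorsionGaloisModule S ρ ((p ^ k : ℕ) : ℤ)).coind (κ.layerSubgroup n) (κ.isOpen_layerSubgroup n))) 1) →
      (∀ w : InfinitePlace ℚ,
        galoisCohomology.localization
            ((cofreeTorsionGaloisModule S ρ ((p ^ k : ℕ) : ℤ)).coind (κ.layerSubgroup n) (κ.isOpen_layerSubgroup n)) (Sum.inl w) 1
            (shapiroLift (cofreeTorsionGaloisModule S ρ ((p ^ k : ℕ) : ℤ)).toTopRep (κ.layerSubgroup n) (κ.isOpen_layerSubgroup n)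
              hs hs1 b) = 0) →
      (∀ v : HeightOneSpectrum (𝓞 ℚ), (p : 𝓞 ℚ) ∈ v.asIdeal →
        galoisCohomology.localization
            ((cofreeTorsionGaloisModule S ρ ((p ^ k : ℕ) : ℤ)).coind (κ.layerSubgroup n) (κ.isOpen_layerSubgroup n)) (Sum.inr v) 1
            (shapiroLift (cofreeTorsionGaloisModule S ρ ((p ^ k : ℕ) : ℤ)).toTopRep (κ.layerSubgroup n) (κ.isOpen_layerSubgroup n)
              hs hs1 b) = 0) →
      ∑ w ∈ S₀, localTatePairingZMod
          ((cofreeTorsionGaloisModule S ρ ((p ^ k : ℕ) : ℤ)).coind (κ.layerSubgroup n) (κ.isOpen_layerSubgroup n)) (p ^ k) (Sum.inr w)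
          (LocalInvariants.canonical ℚ (p ^ k) (Sum.inr w)) (t w)
          (galoisCohomology.localization
            (((cofreeTorsionGaloisModule S ρ ((p ^ k : ℕ) : ℤ)).coind (κ.layerSubgroup n) (κ.isOpen_layerSubgroup n)).tateDual (p ^ k))
            (Sum.inr w) 1
            (cohomologyMap (coindTateDualMor (cofreeTorsionGaloisModule S ρ ((p ^ k : ℕ) : ℤ))
                (cofreeTorsionGaloisModule S ρ ((p ^ k : ℕ) : ℤ)) (κ.layerSubgroup n)
                (pairingHomOfFun (p ^ k) (ePk k) (hμPk k) (hadd₁Pk k) (hadd₂Pk k)) (κ.isOpen_layerSubgroup n)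
                (fun σ a b => (contPairingOfFun (cofreeTorsionGaloisModule S ρ ((p ^ k : ℕ) : ℤ)) (p ^ k) (ePk k) (hμPk k) (hadd₁Pk k)
                  (hadd₂Pk k) (hgalPk k)).toLin_smul σ a b)) 1
              (shapiroLift (cofreeTorsionGaloisModule S ρ ((p ^ k : ℕ) : ℤ)).toTopRep (κ.layerSubgroup n) (κ.isOpen_layerSubgroup n)
                hs hs1 b))) = 0) :
    ∃ c : H1 (cofreeTorsionGaloisModule S ρ ((p ^ k : ℕ) : ℤ)) (κ.layerSubgroup n),
      (∀ w : HeightOneSpectrum (𝓞 ℚ), w ∉ ((↑S₀ : Set (HeightOneSpectrum (𝓞 ℚ))) ∪ {u | (p : 𝓞 ℚ) ∈ u.asIdeal}) →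
        ∀ 𝔓 ∈ w.primesAbove,
          resLe (cofreeTorsionGaloisModule S ρ ((p ^ k : ℕ) : ℤ)).toTopRep
            (inf_le_left : κ.layerSubgroup n ⊓ 𝔓.inertia (absoluteGaloisGroup ℚ) ≤ κ.layerSubgroup n) 1 c = 0) ∧
      ∀ w ∈ S₀,
        galoisCohomology.localization
            ((cofreeTorsionGaloisModule S ρ ((p ^ k : ℕ) : ℤ)).coind (κ.layerSubgroup n) (κ.isOpen_layerSubgroup n)) (Sum.inr w) 1
            (shapiroLift (cofreeTorsionGaloisModule S ρ ((p ^ k : ℕ) : ℤ)).toTopRep (κ.layerSubgroup n) (κ.isOpen_layerSubgroup n)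
              hs hs1 c) = t w := by
  /- ### Level data -/
  haveI : NeZero (p ^ k) := ⟨pow_ne_zero k (Fact.out : p.Prime).ne_zero⟩
  have hN : ∀ m : ↥(AddSubgroup.torsionBy (Cofree ρ ↥(padicCoeffField S)) ((p ^ k : ℕ) : ℤ)), (p ^ k) • m = 0 :=
    fun m => AddSubgroup.torsionBy.nsmul m
  have hM : ∀ m : absoluteGaloisGroup ℚ ⧸ κ.layerSubgroup n → ↥(AddSubgroup.torsionBy (Cofree ρ ↥(padicCoeffField S)) ((p ^ k : ℕ) : ℤ)),
      (p ^ k) • m = 0 := fun φ => funext fun y => hN (φ y)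
  /- ### The finite set `S = {∞} ∪ {w ∋ p} ∪ S₀` and the Selmer structures `𝓕 ≤ 𝓖` on `ρc` -/
  have hSfin : ((↑S₀ : Set (HeightOneSpectrum (𝓞 ℚ))) ∪ {u : HeightOneSpectrum (𝓞 ℚ) | (p : 𝓞 ℚ) ∈ u.asIdeal}).Finite := by
    refine Set.Finite.union S₀.finite_toSet ?_
    have hpne : (p : 𝓞 ℚ) ≠ 0 := by exact_mod_cast (Fact.out : p.Prime).ne_zero
    have hne : Ideal.span {(p : 𝓞 ℚ)} ≠ ⊥ := fun h ↦ hpne (Ideal.span_singleton_eq_bot.mp h)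
    refine (Ideal.finite_factors hne).subset fun w hw ↦ ?_
    simp only [Set.mem_setOf_eq] at hw ⊢
    exact Ideal.dvd_iff_le.mpr ((Ideal.span_singleton_le_iff_mem _).mpr hw)
  let Sset : Set (HeightOneSpectrum (𝓞 ℚ)) := (↑S₀ : Set (HeightOneSpectrum (𝓞 ℚ))) ∪ {u | (p : 𝓞 ℚ) ∈ u.asIdeal}
  let Sfin : Finset (Place ℚ) := (Finset.univ : Finset (InfinitePlace ℚ)).image Sum.inl ∪ hSfin.toFinset.image Sum.inr
  have hSinl : ∀ w : InfinitePlace ℚ, (Sum.inl w : Place ℚ) ∈ Sfin := fun w =>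
    Finset.mem_union_left _ (Finset.mem_image_of_mem _ (Finset.mem_univ w))
  have hSinr : ∀ w : HeightOneSpectrum (𝓞 ℚ), (Sum.inr w : Place ℚ) ∈ Sfin ↔ w ∈ Sset := by
    intro w
    constructor
    · intro h
      rcases Finset.mem_union.mp h with h | h
      · obtain ⟨w', -, hw'⟩ := Finset.mem_image.mp h
        exact absurd hw' Sum.inl_ne_inr
      · obtain ⟨w', hw', heq⟩ := Finset.mem_image.mp h
        rw [← Sum.inr_injective heq]
        exact hSfin.mem_toFinset.mp hw'
    · exact fun h => Finset.mem_union_right _ (Finset.mem_image_of_mem _ (hSfin.mem_toFinset.mpr h))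
  have hnotS : ∀ u : HeightOneSpectrum (𝓞 ℚ), u ∉ Sset → u ∉ S₀ ∧ (p : 𝓞 ℚ) ∉ u.asIdeal := fun u hu =>
    ⟨fun h => hu (Set.mem_union_left _ (Finset.mem_coe.mpr h)), fun h => hu (Set.mem_union_right _ h)⟩
  have hS₀S : ∀ u ∈ S₀, u ∈ Sset := fun u hu => Set.mem_union_left _ (Finset.mem_coe.mpr hu)
  -- `𝓖`: everything on `S`, unramified outside
  let 𝓖 : SelmerStructure ((cofreeTorsionGaloisModule S ρ ((p ^ k : ℕ) : ℤ)).coind (κ.layerSubgroup n) (κ.isOpen_layerSubgroup n)) :=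
    fun w => match w with
      | Sum.inl _ => ⊤
      | Sum.inr u => if u ∈ Sset then ⊤ else
          unramifiedSubgroup (GaloisRep.toLocal u
            ((cofreeTorsionGaloisModule S ρ ((p ^ k : ℕ) : ℤ)).coind (κ.layerSubgroup n) (κ.isOpen_layerSubgroup n))) 1
  -- `𝓕`: `𝓖` made ZERO at `S₀`
  let 𝓕 : SelmerStructure ((cofreeTorsionGaloisModule S ρ ((p ^ k : ℕ) : ℤ)).coind (κ.layerSubgroup n) (κ.isOpen_layerSubgroup n)) :=
    fun w => match w with
      | Sum.inl _ => ⊤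
      | Sum.inr u => if u ∈ Sset then (if (p : 𝓞 ℚ) ∈ u.asIdeal then ⊤ else ⊥) else
          unramifiedSubgroup (GaloisRep.toLocal u
            ((cofreeTorsionGaloisModule S ρ ((p ^ k : ℕ) : ℤ)).coind (κ.layerSubgroup n) (κ.isOpen_layerSubgroup n))) 1
  have h𝓖inl : ∀ w : InfinitePlace ℚ, 𝓖 (Sum.inl w) = ⊤ := fun _ => rfl
  have h𝓕inl : ∀ w : InfinitePlace ℚ, 𝓕 (Sum.inl w) = ⊤ := fun _ => rfl
  have h𝓖S : ∀ u ∈ Sset, 𝓖 (Sum.inr u) = ⊤ := fun u hu => if_pos hu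
  have h𝓕S : ∀ u ∈ Sset, 𝓕 (Sum.inr u) = (if (p : 𝓞 ℚ) ∈ u.asIdeal then ⊤ else ⊥) := fun u hu => if_pos hu
  have h𝓕p : ∀ u : HeightOneSpectrum (𝓞 ℚ), (p : 𝓞 ℚ) ∈ u.asIdeal → 𝓕 (Sum.inr u) = ⊤ := fun u hu =>
    (h𝓕S u (Set.mem_union_right _ hu)).trans (if_pos hu)
  have h𝓕S₀ : ∀ u ∈ S₀, 𝓕 (Sum.inr u) = ⊥ := fun u hu => (h𝓕S u (hS₀S u hu)).trans (if_neg (hS₀ u hu))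
  have h𝓖nS : ∀ u : HeightOneSpectrum (𝓞 ℚ), u ∉ Sset → 𝓖 (Sum.inr u) =
      unramifiedSubgroup (GaloisRep.toLocal u
        ((cofreeTorsionGaloisModule S ρ ((p ^ k : ℕ) : ℤ)).coind (κ.layerSubgroup n) (κ.isOpen_layerSubgroup n))) 1 :=
    fun u hu => if_neg hu
  have h𝓕nS : ∀ u : HeightOneSpectrum (𝓞 ℚ), u ∉ Sset → 𝓕 (Sum.inr u) =
      unramifiedSubgroup (GaloisRep.toLocal u
        ((cofreeTorsionGaloisModule S ρ ((p ^ k : ℕ) : ℤ)).coind (κ.layerSubgroup n) (κ.isOpen_layerSubgroup n))) 1 :=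
    fun u hu => if_neg hu
  have hle : 𝓕 ≤ 𝓖 := by
    intro w
    cases w with
    | inl w => rw [h𝓕inl, h𝓖inl]
    | inr u =>
      by_cases hu : u ∈ Sset
      · rw [h𝓖S u hu]; exact le_top
      · rw [h𝓕nS u hu, h𝓖nS u hu]
  have h𝓖 : 𝓖.IsUnramifiedOutside Sfin :=
    ⟨hSinl, fun u hu => h𝓖nS u fun h => hu ((hSinr u).mpr h)⟩
  have h𝓕 : 𝓕.IsUnramifiedOutside Sfin :=
    ⟨hSinl, fun u hu => h𝓕nS u fun h => hu ((hSinr u).mpr h)⟩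
  have hS' : ∀ u : HeightOneSpectrum (𝓞 ℚ), (Sum.inr u : Place ℚ) ∉ Sfin →
      ((p ^ k : ℕ) : 𝓞 ℚ) ∉ u.asIdeal ∧
        GaloisRep.IsUnramifiedAt u ((cofreeTorsionGaloisModule S ρ ((p ^ k : ℕ) : ℤ)).coind (κ.layerSubgroup n)
          (κ.isOpen_layerSubgroup n)) := by
    intro u hu
    obtain ⟨huS₀, hup⟩ := hnotS u fun h => hu ((hSinr u).mpr h)
    refine ⟨fun h => hup (u.isPrime.mem_of_pow_mem k ?_), ?_⟩
    · rw [← Nat.cast_pow]; exact h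
    · exact isUnramifiedAt_coind_cofreeTorsionGaloisModule_layerSubgroup S ρ κ _ n hup (hρ u huS₀ hup)
  /- ### The prescribed family, extended by `0` off `S₀` -/
  let tf : ∀ v : Place ℚ, galoisCohomology
      (((cofreeTorsionGaloisModule S ρ ((p ^ k : ℕ) : ℤ)).coind (κ.layerSubgroup n) (κ.isOpen_layerSubgroup n)).toLocal v) 1 :=
    fun v => match v with
      | Sum.inl _ => 0
      | Sum.inr w => if w ∈ S₀ then t w else 0
  have htfinl : ∀ w : InfinitePlace ℚ, tf (Sum.inl w) = 0 := fun _ => rfl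
  have htfS₀ : ∀ w ∈ S₀, tf (Sum.inr w) = t w := fun w hw => if_pos hw
  have htfnS₀ : ∀ w : HeightOneSpectrum (𝓞 ℚ), w ∉ S₀ → tf (Sum.inr w) = 0 := fun w hw => if_neg hw
  have ht𝓖 : ∀ v ∈ Sfin, tf v ∈ 𝓖 v := by
    intro v hv
    cases v with
    | inl w => rw [h𝓖inl]; exact AddSubgroup.mem_top _
    | inr u => rw [h𝓖S u ((hSinr u).mp hv)]; exact AddSubgroup.mem_top _
  -- the `S`-sum of THE local pairings against `tf` is the `S₀`-sum against `t`
  have hsum : ∀ y : galoisCohomology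
      (((cofreeTorsionGaloisModule S ρ ((p ^ k : ℕ) : ℤ)).coind (κ.layerSubgroup n) (κ.isOpen_layerSubgroup n)).tateDual (p ^ k)) 1,
      ∑ v ∈ Sfin, localTatePairingZMod
          ((cofreeTorsionGaloisModule S ρ ((p ^ k : ℕ) : ℤ)).coind (κ.layerSubgroup n) (κ.isOpen_layerSubgroup n)) (p ^ k) v
          (LocalInvariants.canonical ℚ (p ^ k) v) (tf v)
          (galoisCohomology.localization
            (((cofreeTorsionGaloisModule S ρ ((p ^ k : ℕ) : ℤ)).coind (κ.layerSubgroup n) (κ.isOpen_layerSubgroup n)).tateDual (p ^ k))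
            v 1 y) =
        ∑ w ∈ S₀, localTatePairingZMod
          ((cofreeTorsionGaloisModule S ρ ((p ^ k : ℕ) : ℤ)).coind (κ.layerSubgroup n) (κ.isOpen_layerSubgroup n)) (p ^ k) (Sum.inr w)
          (LocalInvariants.canonical ℚ (p ^ k) (Sum.inr w)) (t w)
          (galoisCohomology.localization
            (((cofreeTorsionGaloisModule S ρ ((p ^ k : ℕ) : ℤ)).coind (κ.layerSubgroup n) (κ.isOpen_layerSubgroup n)).tateDual (p ^ k))
            (Sum.inr w) 1 y) := by
    intro y
    have hsub : S₀.image (Sum.inr : HeightOneSpectrum (𝓞 ℚ) → Place ℚ) ⊆ Sfin := fun v hv => by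
      obtain ⟨w, hw, rfl⟩ := Finset.mem_image.mp hv
      exact (hSinr w).mpr (hS₀S w hw)
    rw [← Finset.sum_subset hsub, Finset.sum_image fun a _ b _ h => Sum.inr_injective h]
    · exact Finset.sum_congr rfl fun w hw => by rw [htfS₀ w hw]
    · intro v _ hv
      cases v with
      | inl w => rw [htfinl, map_zero, AddMonoidHom.zero_apply]
      | inr u =>
        have hu : u ∉ S₀ := fun h => hv (Finset.mem_image_of_mem _ h)
        rw [htfnS₀ u hu, map_zero, AddMonoidHom.zero_apply]
  /- ### Orthogonality of `tf` to `loc H¹_{𝓕^*}(ℚ, ρc^D)` — the transports + `hT` -/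
  have horth : ∀ y ∈ ((LocalInvariants.canonical ℚ (p ^ k)).dualSelmerStructure
        ((cofreeTorsionGaloisModule S ρ ((p ^ k : ℕ) : ℤ)).coind (κ.layerSubgroup n) (κ.isOpen_layerSubgroup n)) 𝓕).selmerGroup,
      ∑ v ∈ Sfin, localTatePairingZMod
          ((cofreeTorsionGaloisModule S ρ ((p ^ k : ℕ) : ℤ)).coind (κ.layerSubgroup n) (κ.isOpen_layerSubgroup n)) (p ^ k) v
          (LocalInvariants.canonical ℚ (p ^ k) v) (tf v)
          (galoisCohomology.localization
            (((cofreeTorsionGaloisModule S ρ ((p ^ k : ℕ) : ℤ)).coind (κ.layerSubgroup n) (κ.isOpen_layerSubgroup n)).tateDual (p ^ k))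
            v 1 y) = 0 := by
    intro y hy
    rw [hsum]
    -- `y = H¹(Ψ) (Sh b)`
    obtain ⟨b, hb, -⟩ := existsUnique_shapiroLift_coindTateDual_eq (cofreeTorsionGaloisModule S ρ ((p ^ k : ℕ) : ℤ)) (p ^ k) (ePk k)
      (hμPk k) (hadd₁Pk k) (hadd₂Pk k) (hgalPk k) κ hnondeg hN n hs hs1 y
    subst hb
    have hyloc := (SelmerStructure.mem_selmerGroup_iff _ _).mp hy
    -- [unr]
    have hunr : ∀ w : HeightOneSpectrum (𝓞 ℚ), w ∉ S₀ → (p : 𝓞 ℚ) ∉ w.asIdeal →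
        galoisCohomology.localization ((cofreeTorsionGaloisModule S ρ ((p ^ k : ℕ) : ℤ)).coind (κ.layerSubgroup n)
            (κ.isOpen_layerSubgroup n)) (Sum.inr w) 1
            (shapiroLift (cofreeTorsionGaloisModule S ρ ((p ^ k : ℕ) : ℤ)).toTopRep (κ.layerSubgroup n) (κ.isOpen_layerSubgroup n)
              hs hs1 b) ∈
          unramifiedSubgroup (GaloisRep.toLocal w ((cofreeTorsionGaloisModule S ρ ((p ^ k : ℕ) : ℤ)).coind (κ.layerSubgroup n)
            (κ.isOpen_layerSubgroup n))) 1 := by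
      intro w hwS₀ hwp
      have hw : w ∉ Sset := fun h => h.elim (fun h1 => hwS₀ (Finset.mem_coe.mp h1)) (fun h2 => hwp h2)
      have hwS : (Sum.inr w : Place ℚ) ∉ Sfin := fun h => hw ((hSinr w).mp h)
      have h1 := hyloc (Sum.inr w)
      rw [LocalInvariants.dualSelmerStructure_apply, h𝓕nS w hw,
        (SchneiderFreeAdditiveX3.PoitouTateReduction.unramifiedOrthogonal_of_isPerfect_allLevels
          (LocalInvariants.canonical ℚ (p ^ k)) LocalInvariants.canonical_isPerfect _ hM w (hS' w hwS).1 (hS' w hwS).2).1] at h1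
      exact localization_mem_unramifiedSubgroup_of_coindTateDual (cofreeTorsionGaloisModule S ρ ((p ^ k : ℕ) : ℤ)) (p ^ k) (ePk k)
        (hμPk k) (hadd₁Pk k) (hadd₂Pk k) (hgalPk k) (κ.layerSubgroup n) (κ.isOpen_layerSubgroup n) hnondeg hN w _ h1
    -- [inf]
    have hinf : ∀ w : InfinitePlace ℚ,
        galoisCohomology.localization ((cofreeTorsionGaloisModule S ρ ((p ^ k : ℕ) : ℤ)).coind (κ.layerSubgroup n)
          (κ.isOpen_layerSubgroup n)) (Sum.inl w) 1
          (shapiroLift (cofreeTorsionGaloisModule S ρ ((p ^ k : ℕ) : ℤ)).toTopRep (κ.layerSubgroup n) (κ.isOpen_layerSubgroup n)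
            hs hs1 b) = 0 := by
      intro w
      have h1 := hyloc (Sum.inl w)
      rw [LocalInvariants.dualSelmerStructure_apply, h𝓕inl w, LocalInvariants.mem_dualLocalCondition_iff] at h1
      have h2 := eq_zero_of_forall_localTatePairingZMod_canonical_inl_eq_zero (p ^ k) _ hM w _
        fun a => h1 a (AddSubgroup.mem_top a)
      exact localization_eq_zero_of_localization_coindTateDual_eq_zero (cofreeTorsionGaloisModule S ρ ((p ^ k : ℕ) : ℤ)) (p ^ k)
        (ePk k) (hμPk k) (hadd₁Pk k) (hadd₂Pk k) (hgalPk k) (κ.layerSubgroup n) (κ.isOpen_layerSubgroup n) hnondeg hN (Sum.inl w) _ h2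
    -- [p] strict at the places over `p`
    have hp : ∀ v : HeightOneSpectrum (𝓞 ℚ), (p : 𝓞 ℚ) ∈ v.asIdeal →
        galoisCohomology.localization ((cofreeTorsionGaloisModule S ρ ((p ^ k : ℕ) : ℤ)).coind (κ.layerSubgroup n)
          (κ.isOpen_layerSubgroup n)) (Sum.inr v) 1
          (shapiroLift (cofreeTorsionGaloisModule S ρ ((p ^ k : ℕ) : ℤ)).toTopRep (κ.layerSubgroup n) (κ.isOpen_layerSubgroup n)
            hs hs1 b) = 0 := by
      intro v hv
      have h1 := hyloc (Sum.inr v)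
      rw [LocalInvariants.dualSelmerStructure_apply, h𝓕p v hv, LocalInvariants.mem_dualLocalCondition_iff] at h1
      have h2 := eq_zero_of_forall_localTatePairingZMod_canonical_eq_zero (p ^ k) _ hM v _ fun a => h1 a (AddSubgroup.mem_top a)
      exact localization_eq_zero_of_localization_coindTateDual_eq_zero (cofreeTorsionGaloisModule S ρ ((p ^ k : ℕ) : ℤ)) (p ^ k)
        (ePk k) (hμPk k) (hadd₁Pk k) (hadd₂Pk k) (hgalPk k) (κ.layerSubgroup n) (κ.isOpen_layerSubgroup n) hnondeg hN (Sum.inr v) _ h2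
    exact hT b hunr hinf hp
  /- ### `SelmerComplement` (i) for THE canonical family, and the output class `c = Sh⁻¹ x` -/
  obtain ⟨x, hx𝓖, hxloc⟩ :=
    (SchneiderFreeAdditiveX3.PoitouTateReduction.selmerComplement_canonical_holds (K := ℚ) (p ^ k) _ hM Sfin hS' 𝓕 𝓖 hle h𝓕 h𝓖).1
      tf ht𝓖 horth
  obtain ⟨c, hc⟩ := shapiroLift_surjective (cofreeTorsionGaloisModule S ρ ((p ^ k : ℕ) : ℤ)).toTopRep (κ.layerSubgroup n)
    (κ.isOpen_layerSubgroup n) hs hs1 x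
  have hXloc := (SelmerStructure.mem_selmerGroup_iff _ _).mp hx𝓖
  refine ⟨c, ?_, fun w hw => ?_⟩
  · refine admissible_of_forall_localization_shapiroLift_mem S ρ κ _ n hs hs1 (S' := Sset)
      (fun w hw => ⟨(hnotS w hw).2, hρ w (hnotS w hw).1 (hnotS w hw).2⟩) c fun w hw => ?_
    have hwS : (Sum.inr w : Place ℚ) ∉ Sfin := fun h => hw ((hSinr w).mp h)
    have h1 := hXloc (Sum.inr w)
    rw [h𝓖.2 w hwS, ← hc] at h1
    exact h1
  · have h1 := hxloc (Sum.inr w) ((hSinr w).mpr (hS₀S w hw))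
    rw [h𝓕S₀ w hw, htfS₀ w hw, ← hc] at h1
    exact sub_eq_zero.mp ((AddSubgroup.mem_bot).mp h1)

end ThetaTransport.DeepHalfLevelwiseAway

end Summit.BirchSwinnertonDyer.BirchSwinnertonDyer.Theorems

end
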